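import Mathlib

/-!
# Gram trace–rank inequality: `(Σ_i ‖v_i‖²)² ≤ dim span{v_i} · Σ_{i,j} ⟨v_i, v_j⟩²`
# (crux `LevelGradedCohnUmans.GradedDesignFamily`, stmt-MatrixMultiplication-7610; negative side,
# line `quadratic-extension-level-one-cell`, stub `sum_sq_sq_le_finrank_mul_sum_gram_sq`)

For any finite family of real vectors `v_i ∈ ℝ^P` (`i ∈ ι`),

* `sum_sq_sq_le_finrank_mul_sum_gram_sq` —
  `(Σ_i Σ_p (v i p)²)² ≤ finrank ℝ (span ℝ (range v)) · Σ_i Σ_j (Σ_p v i p · v j p)²`,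

i.e. `(Σ_i ‖v_i‖²)² ≤ dim(span{v_i}) · Σ_{i,j} ⟨v_i, v_j⟩²`.  This is the "rank expansion" engine
of the line's negative programme (L1-row: a set `S` of `≥ C q³` lines of `PG(3,q)` spans
`≥ (C/(C+2))(q³+q²)` dimensions of functions on points), in Gram/function form.

Proof: let `B := Matrix.of v : Matrix ι P ℝ` (rows `v_i`) and `G := B * Bᵀ` (the `ι × ι` Gram
matrix, real symmetric).  Then `tr G = Σ_i Σ_p (v i p)²`, `tr (G * G) = Σ_i Σ_j G_ij²`,
`rank G = rank B = finrank (span of the rows of B) = finrank (span (range v))`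
(`Matrix.rank_self_mul_transpose`, `Matrix.rank_eq_finrank_span_row`), and for the symmetric
matrix `G` with eigenvalues `λ_k` we have `tr G = Σ λ_k`, `tr (G * G) = Σ λ_k²` (spectral theorem)
and `rank G = #{k : λ_k ≠ 0}`, so Cauchy–Schwarz over the non-zero eigenvalues gives
`(tr G)² = (Σ_{λ_k ≠ 0} λ_k)² ≤ #{λ_k ≠ 0} · Σ λ_k² = rank G · tr (G * G)`.

Sorry-free; axioms `propext`, `Classical.choice`, `Quot.sound`.
-/

set_option linter.dupNamespace false

open scoped BigOperators Matrix

namespace Summit.MatrixMultiplication.MatrixMultiplication.Theorems.GradedDesignFamily.Negative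

/-- `tr (A * A) = Σ_k λ_k²` for a real symmetric matrix `A` with eigenvalues `λ_k`
(spectral theorem `A = U D Uᵀ` and `tr (U D² Uᵀ) = tr D²`). [folklore] -/
private theorem sum_sq_sq_le_finrank_mul_sum_gram_sq_trace_mul_self {n : Type*} [Fintype n]
    [DecidableEq n] {A : Matrix n n ℝ} (hA : A.IsHermitian) :
    (A * A).trace = ∑ k, hA.eigenvalues k ^ 2 := by
  conv_lhs => rw [hA.spectral_theorem, ← map_mul, Unitary.conjStarAlgAut_apply,
    Matrix.trace_mul_cycle, Unitary.coe_star_mul_self, one_mul, Matrix.diagonal_mul_diagonal,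
    Matrix.trace_diagonal]
  simp [sq]

/-- The trace–rank inequality `(tr A)² ≤ rank A · tr (A * A)` for a real symmetric matrix `A`
(Cauchy–Schwarz over the non-zero eigenvalues). [folklore] -/
private theorem sum_sq_sq_le_finrank_mul_sum_gram_sq_trace_sq_le {n : Type*} [Fintype n]
    [DecidableEq n] {A : Matrix n n ℝ} (hA : A.IsHermitian) :
    A.trace ^ 2 ≤ (A.rank : ℝ) * (A * A).trace := by
  rw [hA.trace_eq_sum_eigenvalues, hA.rank_eq_card_non_zero_eigs,
    sum_sq_sq_le_finrank_mul_sum_gram_sq_trace_mul_self hA, Fintype.card_subtype]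
  simp only [RCLike.ofReal_real_eq_id, id_eq]
  set ev := hA.eigenvalues
  set s := Finset.univ.filter fun i => ev i ≠ 0
  have h1 : ∑ i, ev i = ∑ i ∈ s, 1 * ev i := by
    rw [← Finset.sum_filter_ne_zero]
    exact Finset.sum_congr rfl fun i _ => (one_mul _).symm
  have h2 : ∑ i ∈ s, ev i ^ 2 ≤ ∑ i, ev i ^ 2 :=
    Finset.sum_le_univ_sum_of_nonneg fun i => sq_nonneg _
  have hcard : ∑ i ∈ s, (1 : ℝ) ^ 2 = s.card := by simp
  calc (∑ i, ev i) ^ 2 = (∑ i ∈ s, 1 * ev i) ^ 2 := by rw [h1]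
    _ ≤ (∑ i ∈ s, (1 : ℝ) ^ 2) * ∑ i ∈ s, ev i ^ 2 := Finset.sum_mul_sq_le_sq_mul_sq s _ _
    _ ≤ (s.card : ℝ) * ∑ i, ev i ^ 2 := by
        rw [hcard]
        exact mul_le_mul_of_nonneg_left h2 (Nat.cast_nonneg _)

/-- **Gram trace–rank inequality** (rank expansion engine, Gram/function form): for any finite
family of real vectors `v_i ∈ ℝ^P`,
`(Σ_i ‖v_i‖²)² ≤ dim (span {v_i}) · Σ_{i,j} ⟨v_i, v_j⟩²`. [folklore] -/
theorem sum_sq_sq_le_finrank_mul_sum_gram_sq :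
    ∀ {ι P : Type} [Fintype ι] [Fintype P] [DecidableEq P] (v : ι → P → ℝ),
      (∑ i, ∑ p, v i p ^ 2) ^ 2 ≤
        (Module.finrank ℝ (Submodule.span ℝ (Set.range v)) : ℝ) *
          ∑ i, ∑ j, (∑ p, v i p * v j p) ^ 2 := by
  intro ι P _ _ _ v
  classical
  let B : Matrix ι P ℝ := Matrix.of v
  have hG : (B * Bᵀ).IsHermitian := by
    have h := Matrix.isHermitian_mul_conjTranspose_self B
    rwa [Matrix.conjTranspose_eq_transpose_of_trivial] at h
  have htr : (B * Bᵀ).trace = ∑ i, ∑ p, v i p ^ 2 := by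
    simp [Matrix.trace, Matrix.mul_apply, B, sq]
  have htr2 : ((B * Bᵀ) * (B * Bᵀ)).trace = ∑ i, ∑ j, (∑ p, v i p * v j p) ^ 2 := by
    simp only [Matrix.trace, Matrix.diag_apply, Matrix.mul_apply, Matrix.transpose_apply, B,
      Matrix.of_apply, sq]
    refine Finset.sum_congr rfl fun i _ => Finset.sum_congr rfl fun j _ => ?_
    congr 1
    exact Finset.sum_congr rfl fun p _ => mul_comm _ _
  have hrank : (B * Bᵀ).rank = Module.finrank ℝ (Submodule.span ℝ (Set.range v)) := by
    rw [Matrix.rank_self_mul_transpose, Matrix.rank_eq_finrank_span_row]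
    rfl
  have h := sum_sq_sq_le_finrank_mul_sum_gram_sq_trace_sq_le hG
  rwa [htr, htr2, hrank] at h

end Summit.MatrixMultiplication.MatrixMultiplication.Theorems.GradedDesignFamily.Negative
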